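import Mathlib
import HarnessLib
import HarnessLib.Audit
import Summits.CriticalPhenomena.Statement
import Literature.Probability.RandomPlanarGeometry.RestrictionHulls

/-!
# Lead c9: the FIRST-ENTRANCE form `SequentialSlitAvoidanceFE` of the crux's residual in ROUTE-FILE vocabulary

Companion of `Lines/seqslit_route_vocab.lean`: the same conditional far-slit avoidance, restricted to admissible
FIRST-ENTRANCE limit pasts (`π 0 = a`, `range π` outside the open ball, tip on the sphere) — certified EQUIVALENT to the
unrestricted input by the landed `Transfer.seqSlitAvoidance_iff_firstEntrance : SequentialSlitAvoidance ↔ SequentialSlitAvoidanceFE`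
(`Theorems/SAWLoopFugacityFlowSimpleSubseqLimitsTransferFirstEntrance.lean`). Elaborates with exactly the route file's imports
and `open` lines; the `Iff.rfl` identification with the tree decl is `Lines/seqslitFE_route_vocab_check.lean`. This is the natural
text to file as the crux's child item ("for every admissible first-entrance past"). Not for landing. [difficulty: open-problem]
-/

open scoped BigOperators Topology Manifold Classical MeasureTheory ProbabilityTheory Matrix InnerProductSpace ComplexConjugate ContinuousMap
open Filter Set Function TopologicalSpace MeasureTheory

/-- The item text (first-entrance form; paste as the signature of the promoted / restated item). -/
def SAWSequentialSlitAvoidanceFE : Prop :=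
  ∀ (D : Literature.Probability.RandomPlanarGeometry.DobrushinDomain) (a b : ℝ → Literature.Probability.LatticeModels.Site 2), Literature.Probability.RandomPlanarGeometry.SAW.IsEndpointApprox D a b → ∀ (π : Literature.Probability.RandomPlanarGeometry.Curve ℂ) (q : ℂ) (ρ R : ℝ), 0 < ρ → ρ < R → ((π 1 ∈ Metric.closedBall q ρ) ∧ Set.range (fun u : unitInterval => π u) ⊆ closure D.carrier ∧ ∃ e : C(unitInterval, ℂ), Function.Injective e ∧ Set.range e = Set.range (fun u : unitInterval => π u) ∧ e 0 = D.pt 0 ∧ ∀ u : unitInterval, e u ∈ frontier D.carrier → u = 0) → (π 0 = D.pt 0 ∧ (∀ u : unitInterval, ρ ≤ dist (π u) q) ∧ dist (π 1) q = ρ) → ∀ θ : ℝ, 0 < θ → ∃ ε : ℝ, 0 < ε ∧ ∀ (s : ℕ → ℝ) (t : ℕ → Literature.Probability.LatticeModels.Site 2) (ω : ∀ n : ℕ, Literature.Probability.RandomPlanarGeometry.SAW.DomainSAW D.carrier (s n) (a (s n)) (t n)), Filter.Tendsto s Filter.atTop (nhdsWithin 0 (Set.Ioi 0)) → (∀ n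 : ℕ, Literature.Probability.LatticeModels.meshPoint (s n) (t n) ∈ Metric.closedBall q ρ) → (∀ n : ℕ, ∀ x ∈ (ω n).walk.support.dropLast, Literature.Probability.LatticeModels.meshPoint (s n) x ∉ Metric.closedBall q ρ) → Filter.Tendsto (fun n => (ω n).curve) Filter.atTop (nhds (Literature.Probability.RandomPlanarGeometry.CurveClass.mk π)) → ∀ᶠ n in Filter.atTop, Literature.Probability.RandomPlanarGeometry.SAW.law D.carrier (s n) (a (s n)) (b (s n)) {γ : Literature.Probability.RandomPlanarGeometry.SAW.DomainSAW D.carrier (s n) (a (s n)) (b (s n)) | γ.walk.support.take ((ω n).length + 1) = (ω n).walk.support ∧ ∃ j : ℕ, (ω n).length ≤ j ∧ j ≤ γ.length ∧ ∃ z ∈ ((fun u : unitInterval => π u) '' {u : unitInterval | ∀ u' : unitInterval, u' ≤ u → R < dist (π u') q}), dist (Literature.Probability.LatticeModels.meshPoint (s n) (γ.walk.getVert j)) z < ε} ≤ ENNReal.ofReal θ * Literature.Probability.RandomPlanarGeometry.SAW.law D.carrier (s n) (a (s n)) (b (s n)) {γ : Literature.Probability.RandomPlanarGeometry.SAW.DomainSAW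 D.carrier (s n) (a (s n)) (b (s n)) | γ.walk.support.take ((ω n).length + 1) = (ω n).walk.support}
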